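import Literature.Analysis.FluidPDE.PeriodicCylinderNeumannWeakRadial
import Literature.Analysis.FluidPDE.PeriodicCylinderNeumannPeriodicTest
import HarnessLib

/-!
# The frame class of the weak periodic Neumann problem: closure under all frame derivatives

Topic `Literature/Analysis/FluidPDE`. The **all-orders bookkeeping** of the regularity theory for
the weak periodic Neumann problem on the cylinder `{r ≤ 1} × ℝ/Lℤ` up to the wall
(`PeriodicCylinderHelmholtz`, `…Symmetry`, `…NeumannCovariance`, `…DifferenceQuotients`,
`…NeumannWeakTangential`, `…NeumannWeakRadial`), the analytic input of the local existence
theorem for the Euler equations in the periodic cylinder (T. Kato, C. Y. Lai, J. Funct. Anal.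
**56** (1984), Thm I/II; named fact `Literature.Analysis.FluidPDE.KatoLai1984_periodicCylinderUniformExistence`).

One definition, `PeriodicCylinder.IsFrameClass L` (an inductive predicate on real functions on
`ℝ³`): the class generated by the functions smooth on the closed cylinder and the three frame
components `⟪x_h, ∇q⟫`, `⟪Jx, ∇q⟫`, `⟪e_z, ∇q⟫` of the weak Neumann solutions `∇q[h₀,h₁]`
(`neumannGrad`) with smooth `L`-periodic data, `∫_cell h₀ = 0`, under sums and multiplication by
globally smooth functions. Theorems:

* `IsFrameClass.memLp` — every member is in `L²(cell)` (smooth functions are bounded on the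
  compact closure of the cell, `isCompact_closure_cylinderCell`; the pairings by
  `norm_toCell_inner_le`);
* `IsFrameClass.exists_hasWeakDerivAlong` — **the class is stable under the weak derivatives along
  the frame fields `x_h·∇`, `J·∇`, `∂_z` on the open cell**: each member has along each field a
  weak derivative (`HasWeakDerivAlong`) in the class. Generators: smooth functions classically
  (`HasWeakDerivAlong.of_contDiffOn`, the derivative within the closed cylinder `cylDeriv` being
  again smooth there); the nine frame derivatives of the three frame components are the theorems
  of the two preceding files — tangential ones are frame components of `∇q[∂_J h₀, ∂_J h₁ − Jh₁]`,
  `∇q[∂_z h₀, ∂_z h₁]` (data again smooth periodic with mean-zero scalar part,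
  `IsSmoothPeriodic.cylDeriv_rotGen/_eZ/lieRot`, `IsSmoothPeriodic.setIntegral_cylDeriv_rotGen/_eZ`),
  the radial ones are `P g_J = ⟪x_h, ∇q[∂_J…]⟫`, `P g_z = ⟪x_h, ∇q[∂_z…]⟫` and
  `P g_P = ρ(div h₁ − h₀) − ⟪J, ∇q[∂_J…]⟫ − ρ⟪e_z, ∇q[∂_z…]⟫` (the divergence written within the
  closed cylinder, `contDiffOn_cylDiv`, `cylDiv_eq_divergence`); sums by linearity, smooth multiples
  by the Leibniz rule (`HasWeakDerivAlong.smul`).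

Consequently every frame word of every frame component of `∇q[h₀,h₁]` exists weakly on the open
cell and is square integrable there — the boundary-regularity statement "all tangential and normal
derivatives of all orders are in `L²` near the wall" (Kato–Lai §4 (i), from [14, Thm 5.5.2];
Nirenberg 1955) for the model problem, in weak form. The conversion to Cartesian Sobolev
regularity on the annular part of the cell, the interior, and smoothness up to the wall are the
sequel files.

Mathlib/tree search: `lean search 'IsFrameClass|frame class'` — nothing; the inductive-predicate
packaging is ours. Used: the two preceding files, `HasWeakDerivAlong.of_contDiffOn/add/smul`,
`contDiffOn_cylDeriv`, `cylDeriv_eq_fderiv`, `setIntegral_cylDeriv_rotGen_eq_zero`,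
`setIntegral_cylDeriv_cylBasis_two_eq_zero`, `divergence_eq_sum_fderiv_single`,
`IsCompact.exists_bound_of_continuousOn`, `MemLp.of_bound`, `MemLp.of_le_mul`.

## References

* L. Nirenberg, Comm. Pure Appl. Math. 8 (1955) 649–675. [folklore]
* L. C. Evans, *Partial Differential Equations*, 2nd ed. (2010), §6.3.2 Thm 5 (higher boundary
  regularity, induction on the order). [Evans2010]
* T. Kato, C. Y. Lai, J. Funct. Anal. 56 (1984) 15–28, §4 (i). [KatoLai1984]
-/

noncomputable section

open MeasureTheory Set Function Filter Topology TopologicalSpace WithLp Metric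
open scoped ContDiff NNReal ENNReal InnerProductSpace RealInnerProductSpace

namespace Literature.Analysis.FluidPDE

open Literature.Analysis.FunctionSpaces

/-- Local notation for physical space `ℝ³ = EuclideanSpace ℝ (Fin 3)`. -/
local notation "ℝ³" => EuclideanSpace ℝ (Fin 3)

/-- Local notation for the closed unit cylinder `{r ≤ 1}`. -/
local notation "𝕂" => closure (SetLike.coe unitCylinder : Set (EuclideanSpace ℝ (Fin 3)))

namespace PeriodicCylinder

variable {L : ℝ}

/-! ### The frame class -/

/-- **The frame class** of the period cell: the real functions on `ℝ³` generated by
(i) functions `C^∞` on the closed cylinder, (ii) the three frame components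
`⟪x_h, ∇q⟫`, `⟪Jx, ∇q⟫`, `⟪e_z, ∇q⟫` of (a representative of) the weak periodic Neumann solution
`∇q = ∇q[h₀, h₁]` (`neumannGrad`) for smooth `L`-periodic data with `∫_cell h₀ = 0`, under
(iii) sums and (iv) multiplication by globally smooth functions. Its point
(`IsFrameClass.exists_hasWeakDerivAlong`): it is stable under the weak derivatives along the three
frame fields `x_h·∇`, `J·∇`, `∂_z` on the open cell, so that all frame words of all frame
components of `∇q` exist weakly and are square integrable on the cell. [folklore] -/
inductive IsFrameClass (L : ℝ) : (ℝ³ → ℝ) → Prop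
  | smooth {f : ℝ³ → ℝ} (hf : ContDiffOn ℝ ∞ f 𝕂) : IsFrameClass L f
  | pairP {h₀ : ℝ³ → ℝ} {h₁ : ℝ³ → ℝ³} (hh₀ : IsSmoothPeriodic L h₀) (hh₁ : IsSmoothPeriodic L h₁)
      (hmean : ∫ x in (cylinderCell L : Set ℝ³), h₀ x = 0) :
      IsFrameClass L (fun x => ⟪horizontalProj x, (((neumannGrad L (toCell L h₀) (toCell L h₁) : gradSpace L) :
        Lp ℝ³ 2 (cellMeasure L)) : ℝ³ → ℝ³) x⟫)
  | pairJ {h₀ : ℝ³ → ℝ} {h₁ : ℝ³ → ℝ³} (hh₀ : IsSmoothPeriodic L h₀) (hh₁ : IsSmoothPeriodic L h₁)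
      (hmean : ∫ x in (cylinderCell L : Set ℝ³), h₀ x = 0) :
      IsFrameClass L (fun x => ⟪rotGen x, (((neumannGrad L (toCell L h₀) (toCell L h₁) : gradSpace L) :
        Lp ℝ³ 2 (cellMeasure L)) : ℝ³ → ℝ³) x⟫)
  | pairE {h₀ : ℝ³ → ℝ} {h₁ : ℝ³ → ℝ³} (hh₀ : IsSmoothPeriodic L h₀) (hh₁ : IsSmoothPeriodic L h₁)
      (hmean : ∫ x in (cylinderCell L : Set ℝ³), h₀ x = 0) :
      IsFrameClass L (fun x => ⟪(eZ : ℝ³), (((neumannGrad L (toCell L h₀) (toCell L h₁) : gradSpace L) :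
        Lp ℝ³ 2 (cellMeasure L)) : ℝ³ → ℝ³) x⟫)
  | add {f g : ℝ³ → ℝ} : IsFrameClass L f → IsFrameClass L g → IsFrameClass L (fun x => f x + g x)
  | smul {ψ f : ℝ³ → ℝ} (hψ : ContDiff ℝ ∞ ψ) : IsFrameClass L f → IsFrameClass L (fun x => ψ x * f x)

namespace IsFrameClass

/-- The frame class is closed under negation. [folklore] -/
theorem neg {f : ℝ³ → ℝ} (h : IsFrameClass L f) : IsFrameClass L (fun x => -f x) := by
  have := h.smul (contDiff_const (c := (-1 : ℝ)))
  simpa using this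

/-- The frame class is closed under subtraction. [folklore] -/
theorem sub {f g : ℝ³ → ℝ} (hf : IsFrameClass L f) (hg : IsFrameClass L g) :
    IsFrameClass L (fun x => f x - g x) := by
  have := hf.add hg.neg
  simpa [sub_eq_add_neg] using this

/-- The zero function is in the frame class. [folklore] -/
theorem zero : IsFrameClass L (fun _ : ℝ³ => (0 : ℝ)) := smooth contDiffOn_const

/-- Membership is invariant under pointwise equality (convenience). [folklore] -/
theorem congr {f g : ℝ³ → ℝ} (hf : IsFrameClass L f) (hfg : f = g) : IsFrameClass L g := hfg ▸ hf

end IsFrameClass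

/-! ### Square integrability on the cell -/

/-- The closure of the period cell is compact. [folklore] -/
theorem isCompact_closure_cylinderCell : IsCompact (closure (cylinderCell L : Set ℝ³)) := by
  have hsub : (cylinderCell L : Set ℝ³) ⊆ Metric.closedBall (0 : ℝ³) (1 + |L|) := fun x hx => by
    rw [Metric.mem_closedBall, dist_zero_right, EuclideanSpace.norm_eq]
    have hr : x 0 ^ 2 + x 1 ^ 2 ≤ 1 := by
      have h := hx.1
      rw [cylRadius] at h
      nlinarith [Real.sqrt_nonneg (x 0 ^ 2 + x 1 ^ 2), Real.sq_sqrt (by positivity : (0:ℝ) ≤ x 0 ^ 2 + x 1 ^ 2)]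
    calc Real.sqrt (∑ i : Fin 3, ‖x i‖ ^ 2) = Real.sqrt (x 0 ^ 2 + x 1 ^ 2 + x 2 ^ 2) := by
          simp [Fin.sum_univ_three, Real.norm_eq_abs, sq_abs]
      _ ≤ Real.sqrt ((1 + |L|) ^ 2) :=
          Real.sqrt_le_sqrt (by nlinarith [hx.2.1, hx.2.2, abs_nonneg L, le_abs_self L, abs_nonneg (x 2)])
      _ = 1 + |L| := Real.sqrt_sq (by positivity)
  exact Metric.isCompact_of_isClosed_isBounded isClosed_closure
    ((Metric.isBounded_closedBall.subset hsub).closure)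

/-- The closure of the period cell lies in the closed cylinder. [folklore] -/
theorem closure_cylinderCell_subset_K : closure (cylinderCell L : Set ℝ³) ⊆ 𝕂 :=
  closure_mono (cylinderCell_le_unitCylinder L)

/-- A function continuous on the closed cylinder is square integrable on the cell. [folklore] -/
theorem memLp_of_continuousOn_K {F : Type*} [NormedAddCommGroup F] {f : ℝ³ → F} (hf : ContinuousOn f 𝕂) :
    MemLp f 2 (cellMeasure L) := by
  obtain ⟨R, hR⟩ := isCompact_closure_cylinderCell.exists_bound_of_continuousOn
    (hf.mono closure_cylinderCell_subset_K)
  exact MemLp.of_bound (aestronglyMeasurable_cylinderCell_of_continuousOn L (hf.mono subset_closure))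
    R (ae_restrict_of_forall_mem (cylinderCell L).isOpen.measurableSet fun x hx => hR x (subset_closure hx))

/-- A globally continuous function times a square-integrable one is square integrable on the cell.
[folklore] -/
theorem memLp_continuous_mul {ψ f : ℝ³ → ℝ} (hψ : Continuous ψ) (hf : MemLp f 2 (cellMeasure L)) :
    MemLp (fun x => ψ x * f x) 2 (cellMeasure L) := by
  obtain ⟨R, hR⟩ := isCompact_closure_cylinderCell.exists_bound_of_continuousOn hψ.continuousOn
  refine hf.of_le_mul (c := R) (hψ.aestronglyMeasurable.mul hf.1)
    (ae_restrict_of_forall_mem (cylinderCell L).isOpen.measurableSet fun x hx => ?_)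
  rw [norm_mul]
  exact mul_le_mul_of_nonneg_right (hR x (subset_closure hx)) (norm_nonneg _)

/-- **Every function of the frame class is square integrable on the cell.** [folklore] -/
theorem IsFrameClass.memLp {f : ℝ³ → ℝ} (h : IsFrameClass L f) : MemLp f 2 (cellMeasure L) := by
  induction h with
  | smooth hf => exact memLp_of_continuousOn_K hf.continuousOn
  | pairP hh₀ hh₁ hmean =>
    exact (norm_toCell_inner_le horizontalProjL.continuous zero_le_one (fun x hx => norm_horizontalProj_le_one hx) _).1
  | pairJ hh₀ hh₁ hmean =>
    exact (norm_toCell_inner_le (contDiff_rotGen (n := ∞)).continuous zero_le_one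
      (fun x hx => norm_rotGen_le_one hx) _).1
  | pairE hh₀ hh₁ hmean =>
    refine (norm_toCell_inner_le (continuous_const (y := (eZ : ℝ³))) zero_le_one (fun x _ => ?_) _).1
    rw [eZ_eq_single, PiLp.norm_single, norm_one]
  | add _ _ ihf ihg => exact ihf.add ihg
  | smul hψ _ ih => exact memLp_continuous_mul hψ.continuous ih

/-- Every function of the frame class is locally integrable on the cell. [folklore] -/
theorem IsFrameClass.locallyIntegrableOn {f : ℝ³ → ℝ} (h : IsFrameClass L f) :
    LocallyIntegrableOn f (cylinderCell L : Set ℝ³) volume :=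
  (show IntegrableOn f (cylinderCell L : Set ℝ³) volume from h.memLp.integrable one_le_two).locallyIntegrableOn

/-! ### Differentiated data -/

/-- `∂_J h` is smooth periodic for smooth periodic `h`. [folklore] -/
theorem IsSmoothPeriodic.cylDeriv_rotGen {F : Type*} [NormedAddCommGroup F] [NormedSpace ℝ F] {h : ℝ³ → F}
    (hh : IsSmoothPeriodic L h) : IsSmoothPeriodic L (cylDeriv rotGen h) :=
  ⟨contDiffOn_cylDeriv contDiff_rotGen hh.smooth, hh.periodic.cylDeriv fun x => rotGen_add_axialShift x L⟩

/-- `∂_z h` is smooth periodic for smooth periodic `h`. [folklore] -/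
theorem IsSmoothPeriodic.cylDeriv_eZ {F : Type*} [NormedAddCommGroup F] [NormedSpace ℝ F] {h : ℝ³ → F}
    (hh : IsSmoothPeriodic L h) : IsSmoothPeriodic L (cylDeriv (fun _ => (eZ : ℝ³)) h) :=
  ⟨contDiffOn_cylDeriv contDiff_const hh.smooth, hh.periodic.cylDeriv fun _ => rfl⟩

/-- `∂_J h₁ − J h₁` is smooth periodic for a smooth periodic field `h₁`. [folklore] -/
theorem IsSmoothPeriodic.lieRot {h₁ : ℝ³ → ℝ³} (hh : IsSmoothPeriodic L h₁) :
    IsSmoothPeriodic L (fun x => cylDeriv rotGen h₁ x - rotGen (h₁ x)) :=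
  hh.cylDeriv_rotGen.sub ⟨(rotGenL).contDiff.comp_contDiffOn hh.smooth, fun x => by simp only [hh.periodic x]⟩

/-- `∫_cell ∂_J h₀ = 0` for smooth periodic `h₀`. [folklore] -/
theorem IsSmoothPeriodic.setIntegral_cylDeriv_rotGen (hL : 0 < L) {h₀ : ℝ³ → ℝ} (hh : IsSmoothPeriodic L h₀) :
    ∫ x in (cylinderCell L : Set ℝ³), cylDeriv rotGen h₀ x = 0 :=
  setIntegral_cylDeriv_rotGen_eq_zero hL (hh.smooth.of_le (by exact_mod_cast le_top)) hh.periodic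

/-- `∫_cell ∂_z h₀ = 0` for smooth periodic `h₀`. [folklore] -/
theorem IsSmoothPeriodic.setIntegral_cylDeriv_eZ (hL : 0 < L) {h₀ : ℝ³ → ℝ} (hh : IsSmoothPeriodic L h₀) :
    ∫ x in (cylinderCell L : Set ℝ³), cylDeriv (fun _ => (eZ : ℝ³)) h₀ x = 0 := by
  rw [← cylBasis_two_eq_eZ]
  exact setIntegral_cylDeriv_cylBasis_two_eq_zero hL (hh.smooth.of_le (by exact_mod_cast le_top)) hh.periodic

/-- `R_θ e_z = e_z`. [folklore] -/
theorem rotZ_eZ' (θ : ℝ) : rotZ θ (eZ : ℝ³) = eZ := by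
  ext i; fin_cases i <;> simp [eZ_eq_single]

/-! ### The frame class is stable under the frame derivatives -/

/-- **The frame class is stable under the weak derivatives along the frame fields** `x_h·∇`, `J·∇`,
`∂_z` on the open cell: every `f` of the class has, along each of the three fields, a weak
derivative on the open cell which again lies in the class. The generators are differentiated by
the theorems of `PeriodicCylinderNeumannWeakTangential`/`…WeakRadial` (their outputs are frame
components of weak solutions with the differentiated — again smooth periodic, mean-zero — data,
with polynomial coefficients, plus smooth functions), sums by linearity and smooth multiples by the
Leibniz rule. [folklore] -/
theorem IsFrameClass.exists_hasWeakDerivAlong (hL : 0 < L) {X : ℝ³ → ℝ³}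
    (hX : X = (fun y => horizontalProj y) ∨ X = rotGen ∨ X = fun _ => (eZ : ℝ³)) {f : ℝ³ → ℝ}
    (h : IsFrameClass L f) :
    ∃ f' : ℝ³ → ℝ, IsFrameClass L f' ∧ HasWeakDerivAlong (cylinderCell L) volume X f f' := by
  have hPc : ContDiff ℝ ∞ fun y : ℝ³ => horizontalProj y := horizontalProjL.contDiff
  have hXs : ContDiff ℝ ∞ X := by
    rcases hX with rfl | rfl | rfl
    exacts [hPc, contDiff_rotGen, contDiff_const]
  have hX1 : ContDiff ℝ 1 X := hXs.of_le (by exact_mod_cast le_top)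
  induction h with
  | @smooth f hf =>
    refine ⟨cylDeriv X f, IsFrameClass.smooth (contDiffOn_cylDeriv hXs hf), ?_⟩
    refine (HasWeakDerivAlong.of_contDiffOn (μ := volume) (hf.mono cell_subset_K) hXs).congr_deriv ?_
    filter_upwards [ae_restrict_mem (cylinderCell L).isOpen.measurableSet] with x hx
    exact (cylDeriv_eq_fderiv X f (cylinderCell_le_unitCylinder L hx)).symm
  | @pairP h₀ h₁ hh₀ hh₁ hmean =>
    rcases hX with rfl | rfl | rfl
    · -- `P g_P`: the radial theorem
      have hR := hasWeakDerivAlong_horizontalProj_inner_horizontalProj hL hh₀ hh₁ hmean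
      have hJ' := IsFrameClass.pairJ hh₀.cylDeriv_rotGen hh₁.lieRot (hh₀.setIntegral_cylDeriv_rotGen hL)
      have hE' := IsFrameClass.pairE hh₀.cylDeriv_eZ hh₁.cylDeriv_eZ (hh₀.setIntegral_cylDeriv_eZ hL)
      have hS : IsFrameClass L (fun x => ‖horizontalProj x‖ ^ 2 *
          ((∑ i : Fin 3, (cylDeriv (fun _ => cylBasis i) h₁ x) i) - h₀ x)) :=
        IsFrameClass.smooth (contDiff_rsq.contDiffOn.mul ((contDiffOn_cylDiv hh₁.smooth).sub hh₀.smooth))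
      refine ⟨_, (hS.sub hJ').sub (hE'.smul contDiff_rsq), hR.congr_deriv ?_⟩
      filter_upwards [ae_restrict_mem (cylinderCell L).isOpen.measurableSet] with x hx
      simp only [cylDiv_eq_divergence h₁ (cylinderCell_le_unitCylinder L hx)]
    · -- `J g_P`: pairing
      exact ⟨_, IsFrameClass.pairP hh₀.cylDeriv_rotGen hh₁.lieRot (hh₀.setIntegral_cylDeriv_rotGen hL),
        hasWeakDerivAlong_rotGen_inner_neumannGrad hL hh₀ hh₁ hPc.continuous horizontalProj_rotZ zero_le_one
          fun x hx => norm_horizontalProj_le_one hx⟩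
    · -- `∂_z g_P`: pairing
      exact ⟨_, IsFrameClass.pairP hh₀.cylDeriv_eZ hh₁.cylDeriv_eZ (hh₀.setIntegral_cylDeriv_eZ hL),
        hasWeakDerivAlong_eZ_inner_neumannGrad hL hh₀ hh₁ hPc fderiv_horizontalProj_apply_eZ⟩
  | @pairJ h₀ h₁ hh₀ hh₁ hmean =>
    rcases hX with rfl | rfl | rfl
    · exact ⟨_, IsFrameClass.pairP hh₀.cylDeriv_rotGen hh₁.lieRot (hh₀.setIntegral_cylDeriv_rotGen hL),
        hasWeakDerivAlong_horizontalProj_inner_rotGen hL hh₀ hh₁⟩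
    · exact ⟨_, IsFrameClass.pairJ hh₀.cylDeriv_rotGen hh₁.lieRot (hh₀.setIntegral_cylDeriv_rotGen hL),
        hasWeakDerivAlong_rotGen_inner_neumannGrad hL hh₀ hh₁ (contDiff_rotGen (n := ∞)).continuous rotGen_rotZ
          zero_le_one fun x hx => norm_rotGen_le_one hx⟩
    · exact ⟨_, IsFrameClass.pairJ hh₀.cylDeriv_eZ hh₁.cylDeriv_eZ (hh₀.setIntegral_cylDeriv_eZ hL),
        hasWeakDerivAlong_eZ_inner_neumannGrad hL hh₀ hh₁ contDiff_rotGen fderiv_rotGen_apply_eZ⟩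
  | @pairE h₀ h₁ hh₀ hh₁ hmean =>
    rcases hX with rfl | rfl | rfl
    · exact ⟨_, IsFrameClass.pairP hh₀.cylDeriv_eZ hh₁.cylDeriv_eZ (hh₀.setIntegral_cylDeriv_eZ hL),
        hasWeakDerivAlong_horizontalProj_inner_eZ hL hh₀ hh₁⟩
    · refine ⟨_, IsFrameClass.pairE hh₀.cylDeriv_rotGen hh₁.lieRot (hh₀.setIntegral_cylDeriv_rotGen hL),
        hasWeakDerivAlong_rotGen_inner_neumannGrad hL hh₀ hh₁ (V := fun _ => (eZ : ℝ³)) continuous_const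
          (fun θ x => (rotZ_eZ' θ).symm) zero_le_one fun x _ => ?_⟩
      rw [eZ_eq_single, PiLp.norm_single, norm_one]
    · exact ⟨_, IsFrameClass.pairE hh₀.cylDeriv_eZ hh₁.cylDeriv_eZ (hh₀.setIntegral_cylDeriv_eZ hL),
        hasWeakDerivAlong_eZ_inner_neumannGrad hL hh₀ hh₁ (V := fun _ => (eZ : ℝ³)) contDiff_const fun x => by simp⟩
  | add hf hg ihf ihg =>
    obtain ⟨f', hf'c, hf'⟩ := ihf
    obtain ⟨g', hg'c, hg'⟩ := ihg
    exact ⟨_, hf'c.add hg'c, hf'.add hX1 hg'⟩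
  | @smul ψ f hψ hf ih =>
    obtain ⟨f', hf'c, hf'⟩ := ih
    have hψ' : ContDiff ℝ ∞ fun x => fderiv ℝ ψ x (X x) := (hψ.fderiv_right (m := ∞) (by simp)).clm_apply hXs
    exact ⟨_, (hf.smul hψ').add (hf'c.smul hψ), hf'.smul hX1 hψ⟩

end PeriodicCylinder

end Literature.Analysis.FluidPDE
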